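/-
Copyright (c) 2026 the pub-hodgecm-mathlib formalisation cell (harness21).  Prover seat hodgecm-mathlib-K2E3-p23 (g6), HCML Track B «K2-LIT» ∕ h413
(`stmt-HodgeConjecture-24833`), line `K2_E3_EllipticInputs`, leaf (nsc-S-A′) `sig_K2E3GL3PrincipalBlockStandardSpan`, road «EXP», case brick C1 of the architect's
`MEMO-SA-architecture.v2.K2E3-p25-g2.md` §3 (architect K2E3-p25 (g2) «=» on CENSUS-C1 v0 11:39:48Z; dealer K2E3-plan (g4) D96).  FILE 2 of C1: uniqueness, irreducibility,
identification, traces.  2026-09-04.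
-/
import Summits.HodgeConjecture.HodgeConjecture.Theorems.K2E3GL3OneLinkGeneric     -- ★ C1 file 1 (this seat): `finrank_weightSpace_sub_and_quotient`, `weight_six_cases`; brings ★ REG ∕ EXH ∕ EMB ∕ H0 ∕ ADD ∕ UNIQ deps
import Summits.HodgeConjecture.HodgeConjecture.Theorems.K2E3GL3WeightOneUniqueness -- ★ UNIQ (this seat): `nonempty_equiv_of_finrank_weightSpace_eq_one`, `finrank_weightSpace_add_le_of_inf_eq_bot`
import Literature.NumberTheory.Automorphic.SmoothCharacterAdditive                   -- ★ `smoothTrace_eq_add_of_subrepresentation`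
import Literature.NumberTheory.Automorphic.SmoothCharacterOfCharacter                -- ★ `isAdmissible_trivial_twist`
import Literature.NumberTheory.Automorphic.ParabolicGLProofs                         -- ★ `isAdmissible_parabolicIndGL_holds`
import HarnessLib

/-!
# Crux `H413` — leaf (nsc-S-A′), road «EXP», case C1 «ONE LINK, GENERIC THIRD LETTER», file 2: `I θ` has a UNIQUE proper non-zero subrepresentation; it and the quotient
# are IRREDUCIBLE; an irreducible with a class_A (resp. class_B) weight is ISOMORPHIC to it (resp. to the quotient); the quotient's trace is `tr I θ − tr N`

Cell `hodgecm-mathlib`, Track B; THEOREMS ONLY; count-neutral helper (`--supports stmt-HodgeConjecture-24833 --as helper`).  Currency and setting = ★ C1 file 1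
(`K2E3GL3OneLinkGeneric`): abstract letters `x y z : Fˣ →* ℂˣ`, `θ = ![x,y,z]` regular with open kernels, `z` unlinked to both neighbours (`u₁–u₄`, ★ H0's shape), no swap for
`(x,y)`, `h3cell` = ★ E4a's binder; `N ≤ I θ` with `⊥ ≠ N ≠ ⊤`; class_A = {(x,y,z),(x,z,y),(z,x,y)}, class_B = {(y,x,z),(y,z,x),(z,y,x)}.
* §1 **`forall_finrank_weightSpace_sub_eq`** (two proper non-zero subrepresentations have the same multiplicities everywhere — ★ file 1 on the six weights, `0 ≤ · ≤ mult I = 0`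
  elsewhere), **`eq_of_proper_of_proper`** (UNIQUENESS of the proper non-zero subrepresentation: `N₁ ⊓ N₂ ≠ ⊥` by ★ UNIQ ED. 2 `finrank_weightSpace_add_le_of_inf_eq_bot` at
  `A₁`, then ★ EXH `eq_of_le_of_forall_finrank_weightSpace_eq` twice), **`isIrreducible_sub`**, **`isIrreducible_quotient`**.
* §2 IDENTIFICATION (★ UNIQ (b) `nonempty_equiv_of_finrank_weightSpace_eq_one`): **`nonempty_equiv_sub_of_classA`** — an irreducible smooth `ρ` with `r_B ρ` finite-dimensional
  and a class_A weight is `≅ N` (★ H0 swaps move the weight to `A₁ = tch θ`, multiplicity one in `I θ`); **`nonempty_equiv_quotient_of_classB`** — with a class_B weight it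
  is `≅ I θ ⁄ N` (the weight moves to `B₃ = tch ![z,y,x]`; both `ρ` and `I θ ⁄ N` embed into `I ![z,y,x]`, where `B₃` has multiplicity one — NO intertwining operator needed).
* §3 TRACES: **`smoothTrace_quotient_eq_sub`** — `tr (I θ ⁄ N) = tr (I θ) − tr N` (★ `smoothTrace_eq_add_of_subrepresentation`, `I θ` admissible by ★ `isAdmissible_parabolicIndGL_holds`).
[BernsteinZelevinsky1977, §2.3, Cor. 2.13, Thm. 2.9]; [Zelevinsky1980, §4.2, Thm. 6.1]; [Casselman1995, §6.3].
HONEST LABEL: HC_CM is proved only modulo the 7 printed citations (2 remaining named inputs: hLiu418 = stmt-HodgeConjecture-24832, h413 = stmt-HodgeConjecture-24833) until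
rung 0 closes; count-neutral helper, closes no socket; CONDITIONAL on the binder `h3cell` (E4b) only, stated not assumed as a fact.

## References
* [BernsteinZelevinsky1977] I. N. Bernstein, A. V. Zelevinsky, *Induced representations of reductive p-adic groups I*, Ann. Sci. ÉNS 10 (1977), §2.3, Cor. 2.13, Thm. 2.9.
* [Zelevinsky1980] A. V. Zelevinsky, *Induced representations of reductive p-adic groups II*, Ann. Sci. ÉNS 13 (1980), §4.2, Thm. 6.1.
* [Casselman1995] W. Casselman, *Introduction to the theory of admissible representations of p-adic reductive groups* (draft 1995), §6.3.
-/

set_option autoImplicit false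
-- the mandated namespace repeats `HodgeConjecture.HodgeConjecture`, as in every `Theorems/*.lean` of this sub-problem
set_option linter.dupNamespace false

noncomputable section

open Representation Module Function Literature.NumberTheory.Automorphic Literature.NumberTheory.GaloisRepresentations.IsNonarchimedeanLocalField
open Literature.NumberTheory.GaloisRepresentations Literature.NumberTheory.Automorphic.Zelevinsky1980 Literature.RepresentationTheory.FiniteGroups
open MeasureTheory
open scoped MatrixGroups NNReal
open Summit.HodgeConjecture.HodgeConjecture.Cruxes.H413.K2E3GL3JacquetMultiplicityAdditive
open Summit.HodgeConjecture.HodgeConjecture.Cruxes.H413.K2E3GL3PrincipalSeriesExponents (finrank_weightSpace_principalSeries_three_tch)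
open Summit.HodgeConjecture.HodgeConjecture.Cruxes.H413.K2E3GL3PrincipalSeriesConstituentsJacquetNonzero (nontrivial_coinvariants_of_isConstituentOf_principalSeries_three_tuple)
open Summit.HodgeConjecture.HodgeConjecture.Cruxes.H413.K2E3GL3PrincipalSeriesExhaustion (eq_of_le_of_forall_finrank_weightSpace_eq)
open Summit.HodgeConjecture.HodgeConjecture.Cruxes.H413.K2E3GL3WeightOneUniqueness (nonempty_equiv_of_finrank_weightSpace_eq_one finrank_weightSpace_add_le_of_inf_eq_bot)
open Summit.HodgeConjecture.HodgeConjecture.Cruxes.H413.K2E3GL3StandardModuleEmbedding (isOpen_ker_tch)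
open Summit.HodgeConjecture.HodgeConjecture.Cruxes.H413.K2E3GL3PrincipalSeriesRegular
open Summit.HodgeConjecture.HodgeConjecture.Cruxes.H413.K2E3GL3ExponentRules (finrank_weightSpace_swap₀₁ finrank_weightSpace_swap₁₂)
open Summit.HodgeConjecture.HodgeConjecture.Cruxes.H413.K2E3GL3OneLinkGeneric

namespace Summit.HodgeConjecture.HodgeConjecture.Cruxes.H413.K2E3GL3OneLinkGenericStructure

variable {F : Type} [Field F] [ValuativeRel F] [TopologicalSpace F] [IsNonarchimedeanLocalField F] (x y z : Fˣ →* ℂˣ)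

/-! ## §1 Uniqueness of the proper non-zero subrepresentation; irreducibility -/

set_option maxHeartbeats 800000 in  -- six weights: case bookkeeping as in file 1
/-- **Two proper non-zero subrepresentations of `I θ` have the SAME multiplicities everywhere** (★ file 1 on the six weights; off them both vanish with `mult (I θ)`).
[cite: BernsteinZelevinsky1977, Cor. 2.13, Thm. 2.9] [cite: Zelevinsky1980, §4.2] -/
theorem forall_finrank_weightSpace_sub_eq (hx : IsOpen ((x.ker : Subgroup Fˣ) : Set Fˣ)) (hy : IsOpen ((y.ker : Subgroup Fˣ) : Set Fˣ))
    (hz : IsOpen ((z.ker : Subgroup Fˣ) : Set Fˣ)) (hinj : Function.Injective (![x, y, z] : Fin 3 → (Fˣ →* ℂˣ)))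
    (u₁ : (parabolicIndGL F (lastBlockLabel 2) ((Representation.trivial ℂ (Π a : Bool, GL {i : Fin 2 // lastBlockLabel 2 i = a} F) ℂ).twist (maxParabolicLeviChar F 2 (y) (z)))).IsIrreducible)
    (u₂ : (parabolicIndGL F (lastBlockLabel 2) ((Representation.trivial ℂ (Π a : Bool, GL {i : Fin 2 // lastBlockLabel 2 i = a} F) ℂ).twist (maxParabolicLeviChar F 2 (z) (y)))).IsIrreducible)
    (u₃ : (parabolicIndGL F (lastBlockLabel 2) ((Representation.trivial ℂ (Π a : Bool, GL {i : Fin 2 // lastBlockLabel 2 i = a} F) ℂ).twist (maxParabolicLeviChar F 2 (x) (z)))).IsIrreducible)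
    (u₄ : (parabolicIndGL F (lastBlockLabel 2) ((Representation.trivial ℂ (Π a : Bool, GL {i : Fin 2 // lastBlockLabel 2 i = a} F) ℂ).twist (maxParabolicLeviChar F 2 (z) (x)))).IsIrreducible)
    (h3cell : ∀ c : Fin 3 → Fin 2, Monotone c → Function.Surjective c →
      ∀ (W : Type) [AddCommGroup W] [Module ℂ W] (σ : Representation ℂ (Π a : Fin 2, GL {i : Fin 3 // c i = a} F) W),
        σ.IsIrreducible → σ.IsSmooth → σ.IsSupercuspidal →
        ∀ (N : Subrepresentation (jacquetGL F c (parabolicIndGL F (id : Fin 3 → Fin 3) ((Representation.trivial ℂ (Π a : Fin 3, GL {i : Fin 3 // (id : Fin 3 → Fin 3) i = a} F) ℂ).twist (∏ a : Fin 3, (((![x, y, z] : Fin 3 → (Fˣ →* ℂˣ))) a).comp (Matrix.GeneralLinearGroup.det.comp (Pi.evalMonoidHom (fun a : Fin 3 => GL {i : Fin 3 // (id : Fin 3 → Fin 3) i = a} F) a)))))))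
          (q : N.toRepresentation.IntertwiningMap σ), q = 0)
    (N₁ N₂ : Subrepresentation (parabolicIndGL F (id : Fin 3 → Fin 3) ((Representation.trivial ℂ (Π a : Fin 3, GL {i : Fin 3 // (id : Fin 3 → Fin 3) i = a} F) ℂ).twist (∏ a : Fin 3, (((![x, y, z] : Fin 3 → (Fˣ →* ℂˣ))) a).comp (Matrix.GeneralLinearGroup.det.comp (Pi.evalMonoidHom (fun a : Fin 3 => GL {i : Fin 3 // (id : Fin 3 → Fin 3) i = a} F) a))))))
    (h₁0 : N₁ ≠ ⊥) (h₁1 : N₁ ≠ ⊤) (h₂0 : N₂ ≠ ⊥) (h₂1 : N₂ ≠ ⊤) (χ : (Π a : Fin 3, GL {i : Fin 3 // (id : Fin 3 → Fin 3) i = a} F) → ℂ) :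
    finrank ℂ ↥(⨅ m, Module.End.maxGenEigenspace (normalizedJacquetGL F (id : Fin 3 → Fin 3) N₁.toRepresentation m) (χ m)) =
      finrank ℂ ↥(⨅ m, Module.End.maxGenEigenspace (normalizedJacquetGL F (id : Fin 3 → Fin 3) N₂.toRepresentation m) (χ m)) := by
  have hθo : ∀ i, IsOpen ((((![x, y, z] : Fin 3 → (Fˣ →* ℂˣ)) i).ker : Subgroup Fˣ) : Set Fˣ) := fun i => by
    fin_cases i
    · exact hx
    · exact hy
    · exact hz
  have hIs : (parabolicIndGL F (id : Fin 3 → Fin 3) ((Representation.trivial ℂ (Π a : Fin 3, GL {i : Fin 3 // (id : Fin 3 → Fin 3) i = a} F) ℂ).twist (∏ a : Fin 3, (((![x, y, z] : Fin 3 → (Fˣ →* ℂˣ))) a).comp (Matrix.GeneralLinearGroup.det.comp (Pi.evalMonoidHom (fun a : Fin 3 => GL {i : Fin 3 // (id : Fin 3 → Fin 3) i = a} F) a))))).IsSmooth := Representation.isSmooth_smoothInd _ _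
  haveI hIfd : FiniteDimensional ℂ (restrictUnipotentGL F (id : Fin 3 → Fin 3) (parabolicIndGL F (id : Fin 3 → Fin 3) ((Representation.trivial ℂ (Π a : Fin 3, GL {i : Fin 3 // (id : Fin 3 → Fin 3) i = a} F) ℂ).twist (∏ a : Fin 3, (((![x, y, z] : Fin 3 → (Fˣ →* ℂˣ))) a).comp (Matrix.GeneralLinearGroup.det.comp (Pi.evalMonoidHom (fun a : Fin 3 => GL {i : Fin 3 // (id : Fin 3 → Fin 3) i = a} F) a)))))).Coinvariants :=
    (finrank_weightSpace_principalSeries_three_tch (![x, y, z] : Fin 3 → (Fˣ →* ℂˣ)) (isOpen_ker_tch _ hθo) (fun _ => 0)).1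
  have s₁ := finrank_weightSpace_sub_and_quotient x y z hx hy hz hinj u₁ u₂ u₃ u₄ h3cell N₁ h₁0 h₁1
  have s₂ := finrank_weightSpace_sub_and_quotient x y z hx hy hz hinj u₁ u₂ u₃ u₄ h3cell N₂ h₂0 h₂1
  by_cases hI : finrank ℂ ↥(⨅ m, Module.End.maxGenEigenspace (normalizedJacquetGL F (id : Fin 3 → Fin 3) (parabolicIndGL F (id : Fin 3 → Fin 3) ((Representation.trivial ℂ (Π a : Fin 3, GL {i : Fin 3 // (id : Fin 3 → Fin 3) i = a} F) ℂ).twist (∏ a : Fin 3, (((![x, y, z] : Fin 3 → (Fˣ →* ℂˣ))) a).comp (Matrix.GeneralLinearGroup.det.comp (Pi.evalMonoidHom (fun a : Fin 3 => GL {i : Fin 3 // (id : Fin 3 → Fin 3) i = a} F) a))))) m) (χ m)) = 0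
  · have l₁ := finrank_weightSpace_subrepresentation_le _ hIs N₁ χ
    have l₂ := finrank_weightSpace_subrepresentation_le _ hIs N₂ χ
    have e₁ := Nat.le_zero.1 (l₁.trans hI.le)
    have e₂ := Nat.le_zero.1 (l₂.trans hI.le)
    exact e₁.trans e₂.symm
  · have hsix := weight_six_cases x y z hx hy hz χ hI
    rcases hsix with hv | hv | hv | hv | hv | hv <;> rw [hv]
    · exact s₁.1.trans s₂.1.symm
    · exact s₁.2.1.trans s₂.2.1.symm
    · exact s₁.2.2.2.1.trans s₂.2.2.2.1.symm
    · exact s₁.2.2.2.2.1.trans s₂.2.2.2.2.1.symm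
    · exact s₁.2.2.1.trans s₂.2.2.1.symm
    · exact s₁.2.2.2.2.2.1.trans s₂.2.2.2.2.2.1.symm

/-- **UNIQUENESS OF THE PROPER NON-ZERO SUBREPRESENTATION OF `I θ`**: two proper non-zero subrepresentations `N₁, N₂` coincide — `N₁ ⊓ N₂ ≠ ⊥` (else ★ UNIQ ED. 2
`mult N₁ A₁ + mult N₂ A₁ ≤ mult (I θ) A₁`, i.e. `2 ≤ 1`), so `N₁ ⊓ N₂` is proper non-zero with the multiplicities of `N₁` and of `N₂` (§1), and ★ EXH
`eq_of_le_of_forall_finrank_weightSpace_eq` gives `N₁ ⊓ N₂ = N₁ = N₂`. [cite: BernsteinZelevinsky1977, Cor. 2.13, Thm. 2.9] [cite: Zelevinsky1980, §4.2, Thm. 6.1] -/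
theorem eq_of_proper_of_proper (hx : IsOpen ((x.ker : Subgroup Fˣ) : Set Fˣ)) (hy : IsOpen ((y.ker : Subgroup Fˣ) : Set Fˣ))
    (hz : IsOpen ((z.ker : Subgroup Fˣ) : Set Fˣ)) (hinj : Function.Injective (![x, y, z] : Fin 3 → (Fˣ →* ℂˣ)))
    (u₁ : (parabolicIndGL F (lastBlockLabel 2) ((Representation.trivial ℂ (Π a : Bool, GL {i : Fin 2 // lastBlockLabel 2 i = a} F) ℂ).twist (maxParabolicLeviChar F 2 (y) (z)))).IsIrreducible)
    (u₂ : (parabolicIndGL F (lastBlockLabel 2) ((Representation.trivial ℂ (Π a : Bool, GL {i : Fin 2 // lastBlockLabel 2 i = a} F) ℂ).twist (maxParabolicLeviChar F 2 (z) (y)))).IsIrreducible)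
    (u₃ : (parabolicIndGL F (lastBlockLabel 2) ((Representation.trivial ℂ (Π a : Bool, GL {i : Fin 2 // lastBlockLabel 2 i = a} F) ℂ).twist (maxParabolicLeviChar F 2 (x) (z)))).IsIrreducible)
    (u₄ : (parabolicIndGL F (lastBlockLabel 2) ((Representation.trivial ℂ (Π a : Bool, GL {i : Fin 2 // lastBlockLabel 2 i = a} F) ℂ).twist (maxParabolicLeviChar F 2 (z) (x)))).IsIrreducible)
    (h3cell : ∀ c : Fin 3 → Fin 2, Monotone c → Function.Surjective c →
      ∀ (W : Type) [AddCommGroup W] [Module ℂ W] (σ : Representation ℂ (Π a : Fin 2, GL {i : Fin 3 // c i = a} F) W),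
        σ.IsIrreducible → σ.IsSmooth → σ.IsSupercuspidal →
        ∀ (N : Subrepresentation (jacquetGL F c (parabolicIndGL F (id : Fin 3 → Fin 3) ((Representation.trivial ℂ (Π a : Fin 3, GL {i : Fin 3 // (id : Fin 3 → Fin 3) i = a} F) ℂ).twist (∏ a : Fin 3, (((![x, y, z] : Fin 3 → (Fˣ →* ℂˣ))) a).comp (Matrix.GeneralLinearGroup.det.comp (Pi.evalMonoidHom (fun a : Fin 3 => GL {i : Fin 3 // (id : Fin 3 → Fin 3) i = a} F) a)))))))
          (q : N.toRepresentation.IntertwiningMap σ), q = 0)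
    (N₁ N₂ : Subrepresentation (parabolicIndGL F (id : Fin 3 → Fin 3) ((Representation.trivial ℂ (Π a : Fin 3, GL {i : Fin 3 // (id : Fin 3 → Fin 3) i = a} F) ℂ).twist (∏ a : Fin 3, (((![x, y, z] : Fin 3 → (Fˣ →* ℂˣ))) a).comp (Matrix.GeneralLinearGroup.det.comp (Pi.evalMonoidHom (fun a : Fin 3 => GL {i : Fin 3 // (id : Fin 3 → Fin 3) i = a} F) a))))))
    (h₁0 : N₁ ≠ ⊥) (h₁1 : N₁ ≠ ⊤) (h₂0 : N₂ ≠ ⊥) (h₂1 : N₂ ≠ ⊤) : N₁ = N₂ := by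
  have hθo : ∀ i, IsOpen ((((![x, y, z] : Fin 3 → (Fˣ →* ℂˣ)) i).ker : Subgroup Fˣ) : Set Fˣ) := fun i => by
    fin_cases i
    · exact hx
    · exact hy
    · exact hz
  have hIs : (parabolicIndGL F (id : Fin 3 → Fin 3) ((Representation.trivial ℂ (Π a : Fin 3, GL {i : Fin 3 // (id : Fin 3 → Fin 3) i = a} F) ℂ).twist (∏ a : Fin 3, (((![x, y, z] : Fin 3 → (Fˣ →* ℂˣ))) a).comp (Matrix.GeneralLinearGroup.det.comp (Pi.evalMonoidHom (fun a : Fin 3 => GL {i : Fin 3 // (id : Fin 3 → Fin 3) i = a} F) a))))).IsSmooth := Representation.isSmooth_smoothInd _ _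
  haveI hIfd : FiniteDimensional ℂ (restrictUnipotentGL F (id : Fin 3 → Fin 3) (parabolicIndGL F (id : Fin 3 → Fin 3) ((Representation.trivial ℂ (Π a : Fin 3, GL {i : Fin 3 // (id : Fin 3 → Fin 3) i = a} F) ℂ).twist (∏ a : Fin 3, (((![x, y, z] : Fin 3 → (Fˣ →* ℂˣ))) a).comp (Matrix.GeneralLinearGroup.det.comp (Pi.evalMonoidHom (fun a : Fin 3 => GL {i : Fin 3 // (id : Fin 3 → Fin 3) i = a} F) a)))))).Coinvariants :=
    (finrank_weightSpace_principalSeries_three_tch (![x, y, z] : Fin 3 → (Fˣ →* ℂˣ)) (isOpen_ker_tch _ hθo) (fun _ => 0)).1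
  have hJ := nontrivial_coinvariants_of_isConstituentOf_principalSeries_three_tuple (![x, y, z] : Fin 3 → (Fˣ →* ℂˣ)) h3cell
  have s₁ := finrank_weightSpace_sub_and_quotient x y z hx hy hz hinj u₁ u₂ u₃ u₄ h3cell N₁ h₁0 h₁1
  have s₂ := finrank_weightSpace_sub_and_quotient x y z hx hy hz hinj u₁ u₂ u₃ u₄ h3cell N₂ h₂0 h₂1
  have mI1 : finrank ℂ ↥(⨅ m, Module.End.maxGenEigenspace (normalizedJacquetGL F (id : Fin 3 → Fin 3) (parabolicIndGL F (id : Fin 3 → Fin 3) ((Representation.trivial ℂ (Π a : Fin 3, GL {i : Fin 3 // (id : Fin 3 → Fin 3) i = a} F) ℂ).twist (∏ a : Fin 3, (((![x, y, z] : Fin 3 → (Fˣ →* ℂˣ))) a).comp (Matrix.GeneralLinearGroup.det.comp (Pi.evalMonoidHom (fun a : Fin 3 => GL {i : Fin 3 // (id : Fin 3 → Fin 3) i = a} F) a))))) m) (((∏ a : Fin 3, (((![x, y, z] : Fin 3 → (Fˣ →* ℂˣ))) a).comp (Matrix.GeneralLinearGroup.det.comp (Pi.evalMonoidHom (fun a :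 Fin 3 => GL {i : Fin 3 // (id : Fin 3 → Fin 3) i = a} F) a))) m : ℂˣ) : ℂ)) = 1 :=
    finrank_weightSpace_principalSeries_perm_eq_one _ hθo hinj 1 _ (fun i => by fin_cases i <;> rfl)
  -- `N₁ ⊓ N₂ ≠ ⊥`
  have hinf : N₁ ⊓ N₂ ≠ ⊥ := by
    intro h0
    have hle := finrank_weightSpace_add_le_of_inf_eq_bot _ hIs h0 (fun m : (Π a : Fin 3, GL {i : Fin 3 // (id : Fin 3 → Fin 3) i = a} F) => (((∏ a : Fin 3, (((![x, y, z] : Fin 3 → (Fˣ →* ℂˣ))) a).comp (Matrix.GeneralLinearGroup.det.comp (Pi.evalMonoidHom (fun a : Fin 3 => GL {i : Fin 3 // (id : Fin 3 → Fin 3) i = a} F) a))) m : ℂˣ) : ℂ))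
    have e₁ : finrank ℂ ↥(⨅ m, Module.End.maxGenEigenspace (normalizedJacquetGL F (id : Fin 3 → Fin 3) N₁.toRepresentation m) (((∏ a : Fin 3, (((![x, y, z] : Fin 3 → (Fˣ →* ℂˣ))) a).comp (Matrix.GeneralLinearGroup.det.comp (Pi.evalMonoidHom (fun a : Fin 3 => GL {i : Fin 3 // (id : Fin 3 → Fin 3) i = a} F) a))) m : ℂˣ) : ℂ)) = 1 := s₁.1
    have e₂ : finrank ℂ ↥(⨅ m, Module.End.maxGenEigenspace (normalizedJacquetGL F (id : Fin 3 → Fin 3) N₂.toRepresentation m) (((∏ a : Fin 3, (((![x, y, z] : Fin 3 → (Fˣ →* ℂˣ))) a).comp (Matrix.GeneralLinearGroup.det.comp (Pi.evalMonoidHom (fun a : Fin 3 => GL {i : Fin 3 // (id : Fin 3 → Fin 3) i = a} F) a))) m : ℂˣ) : ℂ)) = 1 := s₂.1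
    have hle' : finrank ℂ ↥(⨅ m, Module.End.maxGenEigenspace (normalizedJacquetGL F (id : Fin 3 → Fin 3) N₁.toRepresentation m) (((∏ a : Fin 3, (((![x, y, z] : Fin 3 → (Fˣ →* ℂˣ))) a).comp (Matrix.GeneralLinearGroup.det.comp (Pi.evalMonoidHom (fun a : Fin 3 => GL {i : Fin 3 // (id : Fin 3 → Fin 3) i = a} F) a))) m : ℂˣ) : ℂ)) + finrank ℂ ↥(⨅ m, Module.End.maxGenEigenspace (normalizedJacquetGL F (id : Fin 3 → Fin 3) N₂.toRepresentation m) (((∏ a : Fin 3, (((![x, y, z] : Fin 3 → (Fˣ →* ℂˣ))) a).comp (Matrix.GeneralLinearGroup.det.comp (Pi.evalMonoidHom (fun a : Fin 3 => GL {i : Fin 3 // (id : Fin 3 → Fin 3) i = a} F) a))) m : ℂˣ) : ℂ)) ≤ finrank ℂ ↥(⨅ m, Module.End.maxGenEigenspace (normalizedJacquetGL F (id : Fin 3 → Fin 3) (parabolicIndGL F (id : Fin 3 → Fin 3) ((Representation.trivial ℂ (Π a : Fin 3, GL {i : Fin 3 // (id : Fin 3 → Fin 3) i = a} F) ℂ).twist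 (∏ a : Fin 3, (((![x, y, z] : Fin 3 → (Fˣ →* ℂˣ))) a).comp (Matrix.GeneralLinearGroup.det.comp (Pi.evalMonoidHom (fun a : Fin 3 => GL {i : Fin 3 // (id : Fin 3 → Fin 3) i = a} F) a))))) m) (((∏ a : Fin 3, (((![x, y, z] : Fin 3 → (Fˣ →* ℂˣ))) a).comp (Matrix.GeneralLinearGroup.det.comp (Pi.evalMonoidHom (fun a : Fin 3 => GL {i : Fin 3 // (id : Fin 3 → Fin 3) i = a} F) a))) m : ℂˣ) : ℂ)) := hle
    have h2 : (1 : ℕ) + 1 ≤ 1 := (Nat.add_le_add e₁.ge e₂.ge).trans (hle'.trans mI1.le)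
    exact absurd h2 (by norm_num)
  have hinf1 : N₁ ⊓ N₂ ≠ ⊤ := fun h => h₁1 (top_le_iff.1 (h ▸ inf_le_left))
  have e1 : N₁ ⊓ N₂ = N₁ := eq_of_le_of_forall_finrank_weightSpace_eq _ hIs hJ inf_le_left
    (forall_finrank_weightSpace_sub_eq x y z hx hy hz hinj u₁ u₂ u₃ u₄ h3cell (N₁ ⊓ N₂) N₁ hinf hinf1 h₁0 h₁1)
  have e2 : N₁ ⊓ N₂ = N₂ := eq_of_le_of_forall_finrank_weightSpace_eq _ hIs hJ inf_le_right
    (forall_finrank_weightSpace_sub_eq x y z hx hy hz hinj u₁ u₂ u₃ u₄ h3cell (N₁ ⊓ N₂) N₂ hinf hinf1 h₂0 h₂1)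
  exact e1.symm.trans e2

/-- **THE PROPER NON-ZERO SUBREPRESENTATION IS IRREDUCIBLE**: a non-zero subrepresentation of `N` is a proper non-zero subrepresentation of `I θ`, hence `= N` (uniqueness).
[cite: BernsteinZelevinsky1977, Thm. 2.9] [cite: Zelevinsky1980, §4.2, Thm. 6.1] -/
theorem isIrreducible_sub (hx : IsOpen ((x.ker : Subgroup Fˣ) : Set Fˣ)) (hy : IsOpen ((y.ker : Subgroup Fˣ) : Set Fˣ))
    (hz : IsOpen ((z.ker : Subgroup Fˣ) : Set Fˣ)) (hinj : Function.Injective (![x, y, z] : Fin 3 → (Fˣ →* ℂˣ)))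
    (u₁ : (parabolicIndGL F (lastBlockLabel 2) ((Representation.trivial ℂ (Π a : Bool, GL {i : Fin 2 // lastBlockLabel 2 i = a} F) ℂ).twist (maxParabolicLeviChar F 2 (y) (z)))).IsIrreducible)
    (u₂ : (parabolicIndGL F (lastBlockLabel 2) ((Representation.trivial ℂ (Π a : Bool, GL {i : Fin 2 // lastBlockLabel 2 i = a} F) ℂ).twist (maxParabolicLeviChar F 2 (z) (y)))).IsIrreducible)
    (u₃ : (parabolicIndGL F (lastBlockLabel 2) ((Representation.trivial ℂ (Π a : Bool, GL {i : Fin 2 // lastBlockLabel 2 i = a} F) ℂ).twist (maxParabolicLeviChar F 2 (x) (z)))).IsIrreducible)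
    (u₄ : (parabolicIndGL F (lastBlockLabel 2) ((Representation.trivial ℂ (Π a : Bool, GL {i : Fin 2 // lastBlockLabel 2 i = a} F) ℂ).twist (maxParabolicLeviChar F 2 (z) (x)))).IsIrreducible)
    (h3cell : ∀ c : Fin 3 → Fin 2, Monotone c → Function.Surjective c →
      ∀ (W : Type) [AddCommGroup W] [Module ℂ W] (σ : Representation ℂ (Π a : Fin 2, GL {i : Fin 3 // c i = a} F) W),
        σ.IsIrreducible → σ.IsSmooth → σ.IsSupercuspidal →
        ∀ (N : Subrepresentation (jacquetGL F c (parabolicIndGL F (id : Fin 3 → Fin 3) ((Representation.trivial ℂ (Π a : Fin 3, GL {i : Fin 3 // (id : Fin 3 → Fin 3) i = a} F) ℂ).twist (∏ a : Fin 3, (((![x, y, z] : Fin 3 → (Fˣ →* ℂˣ))) a).comp (Matrix.GeneralLinearGroup.det.comp (Pi.evalMonoidHom (fun a : Fin 3 => GL {i : Fin 3 // (id : Fin 3 → Fin 3) i = a} F) a)))))))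
          (q : N.toRepresentation.IntertwiningMap σ), q = 0)
    (N : Subrepresentation (parabolicIndGL F (id : Fin 3 → Fin 3) ((Representation.trivial ℂ (Π a : Fin 3, GL {i : Fin 3 // (id : Fin 3 → Fin 3) i = a} F) ℂ).twist (∏ a : Fin 3, (((![x, y, z] : Fin 3 → (Fˣ →* ℂˣ))) a).comp (Matrix.GeneralLinearGroup.det.comp (Pi.evalMonoidHom (fun a : Fin 3 => GL {i : Fin 3 // (id : Fin 3 → Fin 3) i = a} F) a))))))
    (hN0 : N ≠ ⊥) (hN1 : N ≠ ⊤) : N.toRepresentation.IsIrreducible := by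
  haveI : Nontrivial ↥N.toSubmodule := Submodule.nontrivial_iff_ne_bot.2 fun h => hN0 (Subrepresentation.toSubmodule_injective h)
  haveI : Nontrivial (Subrepresentation N.toRepresentation) :=
    ⟨⟨⊥, ⊤, fun h => by
      obtain ⟨v, hv⟩ := exists_ne (0 : ↥N.toSubmodule)
      have : v ∈ (⊥ : Subrepresentation N.toRepresentation) := by rw [h]; trivial
      exact hv ((Submodule.mem_bot ℂ).1 this)⟩⟩
  refine ⟨fun M => ?_⟩
  -- `M` read inside `I θ`
  let M' : Subrepresentation (parabolicIndGL F (id : Fin 3 → Fin 3) ((Representation.trivial ℂ (Π a : Fin 3, GL {i : Fin 3 // (id : Fin 3 → Fin 3) i = a} F) ℂ).twist (∏ a : Fin 3, (((![x, y, z] : Fin 3 → (Fˣ →* ℂˣ))) a).comp (Matrix.GeneralLinearGroup.det.comp (Pi.evalMonoidHom (fun a : Fin 3 => GL {i : Fin 3 // (id : Fin 3 → Fin 3) i = a} F) a))))) :=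
    ⟨M.toSubmodule.map N.toSubmodule.subtype, fun g w hw => by
      obtain ⟨v, hv, rfl⟩ := hw
      exact ⟨N.toRepresentation g v, M.apply_mem_toSubmodule g hv, rfl⟩⟩
  have hM'N : M' ≤ N := fun w hw => by
    obtain ⟨v, -, rfl⟩ := hw
    exact v.2
  by_cases hM' : M' = ⊥
  · left
    refine le_bot_iff.1 fun v hv => ?_
    have hvM : v.1 ∈ M' := ⟨v, hv, rfl⟩
    rw [hM'] at hvM
    have h0 : v.1 = 0 := (Submodule.mem_bot ℂ).1 hvM
    exact (Submodule.mem_bot ℂ).2 (Subtype.ext h0)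
  · right
    have hM'1 : M' ≠ ⊤ := fun h => hN1 (top_le_iff.1 (h ▸ hM'N))
    have hEq : M' = N := eq_of_proper_of_proper x y z hx hy hz hinj u₁ u₂ u₃ u₄ h3cell M' N hM' hM'1 hN0 hN1
    refine top_le_iff.1 fun v _ => ?_
    have hv : v.1 ∈ M' := by rw [hEq]; exact v.2
    obtain ⟨w, hw, hwv⟩ := hv
    have hwv' : w = v := Subtype.ext hwv
    exact hwv' ▸ hw

/-- **THE QUOTIENT `I θ ⁄ N` IS IRREDUCIBLE**: a subrepresentation of the quotient pulls back to a subrepresentation of `I θ` containing `N`, which is `N` or `⊤` (uniqueness).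
[cite: BernsteinZelevinsky1977, Thm. 2.9] [cite: Zelevinsky1980, §4.2, Thm. 6.1] -/
theorem isIrreducible_quotient (hx : IsOpen ((x.ker : Subgroup Fˣ) : Set Fˣ)) (hy : IsOpen ((y.ker : Subgroup Fˣ) : Set Fˣ))
    (hz : IsOpen ((z.ker : Subgroup Fˣ) : Set Fˣ)) (hinj : Function.Injective (![x, y, z] : Fin 3 → (Fˣ →* ℂˣ)))
    (u₁ : (parabolicIndGL F (lastBlockLabel 2) ((Representation.trivial ℂ (Π a : Bool, GL {i : Fin 2 // lastBlockLabel 2 i = a} F) ℂ).twist (maxParabolicLeviChar F 2 (y) (z)))).IsIrreducible)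
    (u₂ : (parabolicIndGL F (lastBlockLabel 2) ((Representation.trivial ℂ (Π a : Bool, GL {i : Fin 2 // lastBlockLabel 2 i = a} F) ℂ).twist (maxParabolicLeviChar F 2 (z) (y)))).IsIrreducible)
    (u₃ : (parabolicIndGL F (lastBlockLabel 2) ((Representation.trivial ℂ (Π a : Bool, GL {i : Fin 2 // lastBlockLabel 2 i = a} F) ℂ).twist (maxParabolicLeviChar F 2 (x) (z)))).IsIrreducible)
    (u₄ : (parabolicIndGL F (lastBlockLabel 2) ((Representation.trivial ℂ (Π a : Bool, GL {i : Fin 2 // lastBlockLabel 2 i = a} F) ℂ).twist (maxParabolicLeviChar F 2 (z) (x)))).IsIrreducible)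
    (h3cell : ∀ c : Fin 3 → Fin 2, Monotone c → Function.Surjective c →
      ∀ (W : Type) [AddCommGroup W] [Module ℂ W] (σ : Representation ℂ (Π a : Fin 2, GL {i : Fin 3 // c i = a} F) W),
        σ.IsIrreducible → σ.IsSmooth → σ.IsSupercuspidal →
        ∀ (N : Subrepresentation (jacquetGL F c (parabolicIndGL F (id : Fin 3 → Fin 3) ((Representation.trivial ℂ (Π a : Fin 3, GL {i : Fin 3 // (id : Fin 3 → Fin 3) i = a} F) ℂ).twist (∏ a : Fin 3, (((![x, y, z] : Fin 3 → (Fˣ →* ℂˣ))) a).comp (Matrix.GeneralLinearGroup.det.comp (Pi.evalMonoidHom (fun a : Fin 3 => GL {i : Fin 3 // (id : Fin 3 → Fin 3) i = a} F) a)))))))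
          (q : N.toRepresentation.IntertwiningMap σ), q = 0)
    (N : Subrepresentation (parabolicIndGL F (id : Fin 3 → Fin 3) ((Representation.trivial ℂ (Π a : Fin 3, GL {i : Fin 3 // (id : Fin 3 → Fin 3) i = a} F) ℂ).twist (∏ a : Fin 3, (((![x, y, z] : Fin 3 → (Fˣ →* ℂˣ))) a).comp (Matrix.GeneralLinearGroup.det.comp (Pi.evalMonoidHom (fun a : Fin 3 => GL {i : Fin 3 // (id : Fin 3 → Fin 3) i = a} F) a))))))
    (hN0 : N ≠ ⊥) (hN1 : N ≠ ⊤) : N.quotientRep.IsIrreducible := by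
  have hNt : N.toSubmodule ≠ ⊤ := fun h' => hN1 (Subrepresentation.toSubmodule_injective h')
  haveI : Nontrivial (_ ⧸ N.toSubmodule) := Submodule.Quotient.nontrivial_iff.2 hNt
  haveI : Nontrivial (Subrepresentation N.quotientRep) :=
    ⟨⟨⊥, ⊤, fun h => by
      obtain ⟨v, hv⟩ := exists_ne (0 : _ ⧸ N.toSubmodule)
      have : v ∈ (⊥ : Subrepresentation N.quotientRep) := by rw [h]; trivial
      exact hv ((Submodule.mem_bot ℂ).1 this)⟩⟩
  refine ⟨fun M => ?_⟩
  have hle := N.le_comapMkQ M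
  have hne : N.comapMkQ M ≠ ⊥ := fun h => hN0 (le_bot_iff.1 (h ▸ hle))
  by_cases htop : N.comapMkQ M = ⊤
  · right
    refine top_le_iff.1 fun q _ => ?_
    obtain ⟨v, rfl⟩ := N.mkQ_surjective q
    have hv : v ∈ N.comapMkQ M := by rw [htop]; trivial
    exact hv
  · left
    have hEq : N.comapMkQ M = N := eq_of_proper_of_proper x y z hx hy hz hinj u₁ u₂ u₃ u₄ h3cell _ N hne htop hN0 hN1
    refine le_bot_iff.1 fun q hq => ?_
    obtain ⟨v, rfl⟩ := N.mkQ_surjective q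
    have hv : v ∈ N.comapMkQ M := hq
    rw [hEq] at hv
    exact (Submodule.mem_bot ℂ).2 ((N.mkQ_eq_zero_iff v).2 hv)

/-! ## §2 Identification of an irreducible by one weight -/

section Identification

variable {V : Type} [AddCommGroup V] [Module ℂ V] (ρ : Representation ℂ (GL (Fin 3) F) V)

set_option maxHeartbeats 800000 in  -- six weights: case bookkeeping as in file 1
/-- **AN IRREDUCIBLE WITH A class_A WEIGHT IS `≅ N`**: for `ρ` irreducible smooth with `r_B ρ` finite-dimensional and `mult ρ Aᵢ ≠ 0` for some `i`, `ρ ≅ N` — the ★ H0 swaps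
move the weight to `A₁ = tch θ` (multiplicity one in `I θ`, ★ REG), `N` carries `A₁` (★ file 1), ★ UNIQ (b). [cite: BernsteinZelevinsky1977, Cor. 2.13, Thm. 2.9] [cite: Zelevinsky1980, Thm. 6.1] -/
theorem nonempty_equiv_sub_of_classA (hx : IsOpen ((x.ker : Subgroup Fˣ) : Set Fˣ)) (hy : IsOpen ((y.ker : Subgroup Fˣ) : Set Fˣ))
    (hz : IsOpen ((z.ker : Subgroup Fˣ) : Set Fˣ)) (hinj : Function.Injective (![x, y, z] : Fin 3 → (Fˣ →* ℂˣ)))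
    (u₁ : (parabolicIndGL F (lastBlockLabel 2) ((Representation.trivial ℂ (Π a : Bool, GL {i : Fin 2 // lastBlockLabel 2 i = a} F) ℂ).twist (maxParabolicLeviChar F 2 (y) (z)))).IsIrreducible)
    (u₂ : (parabolicIndGL F (lastBlockLabel 2) ((Representation.trivial ℂ (Π a : Bool, GL {i : Fin 2 // lastBlockLabel 2 i = a} F) ℂ).twist (maxParabolicLeviChar F 2 (z) (y)))).IsIrreducible)
    (u₃ : (parabolicIndGL F (lastBlockLabel 2) ((Representation.trivial ℂ (Π a : Bool, GL {i : Fin 2 // lastBlockLabel 2 i = a} F) ℂ).twist (maxParabolicLeviChar F 2 (x) (z)))).IsIrreducible)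
    (u₄ : (parabolicIndGL F (lastBlockLabel 2) ((Representation.trivial ℂ (Π a : Bool, GL {i : Fin 2 // lastBlockLabel 2 i = a} F) ℂ).twist (maxParabolicLeviChar F 2 (z) (x)))).IsIrreducible)
    (h3cell : ∀ c : Fin 3 → Fin 2, Monotone c → Function.Surjective c →
      ∀ (W : Type) [AddCommGroup W] [Module ℂ W] (σ : Representation ℂ (Π a : Fin 2, GL {i : Fin 3 // c i = a} F) W),
        σ.IsIrreducible → σ.IsSmooth → σ.IsSupercuspidal →
        ∀ (N : Subrepresentation (jacquetGL F c (parabolicIndGL F (id : Fin 3 → Fin 3) ((Representation.trivial ℂ (Π a : Fin 3, GL {i : Fin 3 // (id : Fin 3 → Fin 3) i = a} F) ℂ).twist (∏ a : Fin 3, (((![x, y, z] : Fin 3 → (Fˣ →* ℂˣ))) a).comp (Matrix.GeneralLinearGroup.det.comp (Pi.evalMonoidHom (fun a : Fin 3 => GL {i : Fin 3 // (id : Fin 3 → Fin 3) i = a} F) a)))))))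
          (q : N.toRepresentation.IntertwiningMap σ), q = 0)
    (N : Subrepresentation (parabolicIndGL F (id : Fin 3 → Fin 3) ((Representation.trivial ℂ (Π a : Fin 3, GL {i : Fin 3 // (id : Fin 3 → Fin 3) i = a} F) ℂ).twist (∏ a : Fin 3, (((![x, y, z] : Fin 3 → (Fˣ →* ℂˣ))) a).comp (Matrix.GeneralLinearGroup.det.comp (Pi.evalMonoidHom (fun a : Fin 3 => GL {i : Fin 3 // (id : Fin 3 → Fin 3) i = a} F) a))))))
    (hN0 : N ≠ ⊥) (hN1 : N ≠ ⊤) [ρ.IsIrreducible] (hρ : ρ.IsSmooth) [FiniteDimensional ℂ (restrictUnipotentGL F (id : Fin 3 → Fin 3) ρ).Coinvariants]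
    (hw : finrank ℂ ↥(⨅ m, Module.End.maxGenEigenspace (normalizedJacquetGL F (id : Fin 3 → Fin 3) ρ m) (((∏ a : Fin 3, (((![x, y, z] : Fin 3 → (Fˣ →* ℂˣ))) a).comp (Matrix.GeneralLinearGroup.det.comp (Pi.evalMonoidHom (fun a : Fin 3 => GL {i : Fin 3 // (id : Fin 3 → Fin 3) i = a} F) a))) m : ℂˣ) : ℂ)) ≠ 0 ∨
      finrank ℂ ↥(⨅ m, Module.End.maxGenEigenspace (normalizedJacquetGL F (id : Fin 3 → Fin 3) ρ m) (((∏ a : Fin 3, (((![x, z, y] : Fin 3 → (Fˣ →* ℂˣ))) a).comp (Matrix.GeneralLinearGroup.det.comp (Pi.evalMonoidHom (fun a : Fin 3 => GL {i : Fin 3 // (id : Fin 3 → Fin 3) i = a} F) a))) m : ℂˣ) : ℂ)) ≠ 0 ∨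
      finrank ℂ ↥(⨅ m, Module.End.maxGenEigenspace (normalizedJacquetGL F (id : Fin 3 → Fin 3) ρ m) (((∏ a : Fin 3, (((![z, x, y] : Fin 3 → (Fˣ →* ℂˣ))) a).comp (Matrix.GeneralLinearGroup.det.comp (Pi.evalMonoidHom (fun a : Fin 3 => GL {i : Fin 3 // (id : Fin 3 → Fin 3) i = a} F) a))) m : ℂˣ) : ℂ)) ≠ 0) :
    Nonempty (ρ.Equiv N.toRepresentation) := by
  have hθo : ∀ i, IsOpen ((((![x, y, z] : Fin 3 → (Fˣ →* ℂˣ)) i).ker : Subgroup Fˣ) : Set Fˣ) := fun i => by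
    fin_cases i
    · exact hx
    · exact hy
    · exact hz
  have hIs : (parabolicIndGL F (id : Fin 3 → Fin 3) ((Representation.trivial ℂ (Π a : Fin 3, GL {i : Fin 3 // (id : Fin 3 → Fin 3) i = a} F) ℂ).twist (∏ a : Fin 3, (((![x, y, z] : Fin 3 → (Fˣ →* ℂˣ))) a).comp (Matrix.GeneralLinearGroup.det.comp (Pi.evalMonoidHom (fun a : Fin 3 => GL {i : Fin 3 // (id : Fin 3 → Fin 3) i = a} F) a))))).IsSmooth := Representation.isSmooth_smoothInd _ _
  haveI hIfd : FiniteDimensional ℂ (restrictUnipotentGL F (id : Fin 3 → Fin 3) (parabolicIndGL F (id : Fin 3 → Fin 3) ((Representation.trivial ℂ (Π a : Fin 3, GL {i : Fin 3 // (id : Fin 3 → Fin 3) i = a} F) ℂ).twist (∏ a : Fin 3, (((![x, y, z] : Fin 3 → (Fˣ →* ℂˣ))) a).comp (Matrix.GeneralLinearGroup.det.comp (Pi.evalMonoidHom (fun a : Fin 3 => GL {i : Fin 3 // (id : Fin 3 → Fin 3) i = a} F) a)))))).Coinvariants :=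
    (finrank_weightSpace_principalSeries_three_tch (![x, y, z] : Fin 3 → (Fˣ →* ℂˣ)) (isOpen_ker_tch _ hθo) (fun _ => 0)).1
  have hRs : N.toRepresentation.IsSmooth := hIs.toRepresentation N
  haveI : FiniteDimensional ℂ (restrictUnipotentGL F (id : Fin 3 → Fin 3) N.toRepresentation).Coinvariants := finiteDimensional_jacquet_subrepresentation _ monotone_id hIs N
  haveI := isIrreducible_sub x y z hx hy hz hinj u₁ u₂ u₃ u₄ h3cell N hN0 hN1
  have s := finrank_weightSpace_sub_and_quotient x y z hx hy hz hinj u₁ u₂ u₃ u₄ h3cell N hN0 hN1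
  have mI1 : finrank ℂ ↥(⨅ m, Module.End.maxGenEigenspace (normalizedJacquetGL F (id : Fin 3 → Fin 3) (parabolicIndGL F (id : Fin 3 → Fin 3) ((Representation.trivial ℂ (Π a : Fin 3, GL {i : Fin 3 // (id : Fin 3 → Fin 3) i = a} F) ℂ).twist (∏ a : Fin 3, (((![x, y, z] : Fin 3 → (Fˣ →* ℂˣ))) a).comp (Matrix.GeneralLinearGroup.det.comp (Pi.evalMonoidHom (fun a : Fin 3 => GL {i : Fin 3 // (id : Fin 3 → Fin 3) i = a} F) a))))) m) (((∏ a : Fin 3, (((![x, y, z] : Fin 3 → (Fˣ →* ℂˣ))) a).comp (Matrix.GeneralLinearGroup.det.comp (Pi.evalMonoidHom (fun a : Fin 3 => GL {i : Fin 3 // (id : Fin 3 → Fin 3) i = a} F) a))) m : ℂˣ) : ℂ)) = 1 :=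
    finrank_weightSpace_principalSeries_perm_eq_one _ hθo hinj 1 _ (fun i => by fin_cases i <;> rfl)
  have r12 : finrank ℂ ↥(⨅ m, Module.End.maxGenEigenspace (normalizedJacquetGL F (id : Fin 3 → Fin 3) ρ m) (((∏ a : Fin 3, (((![x, y, z] : Fin 3 → (Fˣ →* ℂˣ))) a).comp (Matrix.GeneralLinearGroup.det.comp (Pi.evalMonoidHom (fun a : Fin 3 => GL {i : Fin 3 // (id : Fin 3 → Fin 3) i = a} F) a))) m : ℂˣ) : ℂ)) = finrank ℂ ↥(⨅ m, Module.End.maxGenEigenspace (normalizedJacquetGL F (id : Fin 3 → Fin 3) ρ m) (((∏ a : Fin 3, (((![x, z, y] : Fin 3 → (Fˣ →* ℂˣ))) a).comp (Matrix.GeneralLinearGroup.det.comp (Pi.evalMonoidHom (fun a : Fin 3 => GL {i : Fin 3 // (id : Fin 3 → Fin 3) i = a} F) a))) m : ℂˣ) : ℂ)) := finrank_weightSpace_swap₁₂ _ hρ _ _ _ hy hz u₁ u₂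
  have r23 : finrank ℂ ↥(⨅ m, Module.End.maxGenEigenspace (normalizedJacquetGL F (id : Fin 3 → Fin 3) ρ m) (((∏ a : Fin 3, (((![x, z, y] : Fin 3 → (Fˣ →* ℂˣ))) a).comp (Matrix.GeneralLinearGroup.det.comp (Pi.evalMonoidHom (fun a : Fin 3 => GL {i : Fin 3 // (id : Fin 3 → Fin 3) i = a} F) a))) m : ℂˣ) : ℂ)) = finrank ℂ ↥(⨅ m, Module.End.maxGenEigenspace (normalizedJacquetGL F (id : Fin 3 → Fin 3) ρ m) (((∏ a : Fin 3, (((![z, x, y] : Fin 3 → (Fˣ →* ℂˣ))) a).comp (Matrix.GeneralLinearGroup.det.comp (Pi.evalMonoidHom (fun a : Fin 3 => GL {i : Fin 3 // (id : Fin 3 → Fin 3) i = a} F) a))) m : ℂˣ) : ℂ)) := finrank_weightSpace_swap₀₁ _ hρ _ _ _ hx hz u₃ u₄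
  have h1 : finrank ℂ ↥(⨅ m, Module.End.maxGenEigenspace (normalizedJacquetGL F (id : Fin 3 → Fin 3) ρ m) (((∏ a : Fin 3, (((![x, y, z] : Fin 3 → (Fˣ →* ℂˣ))) a).comp (Matrix.GeneralLinearGroup.det.comp (Pi.evalMonoidHom (fun a : Fin 3 => GL {i : Fin 3 // (id : Fin 3 → Fin 3) i = a} F) a))) m : ℂˣ) : ℂ)) ≠ 0 := by
    rcases hw with h | h | h
    · exact h
    · exact fun h0 => h (r12 ▸ h0)
    · exact fun h0 => h (r23 ▸ r12 ▸ h0)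
  have hN : finrank ℂ ↥(⨅ m, Module.End.maxGenEigenspace (normalizedJacquetGL F (id : Fin 3 → Fin 3) N.toRepresentation m) (((∏ a : Fin 3, (((![x, y, z] : Fin 3 → (Fˣ →* ℂˣ))) a).comp (Matrix.GeneralLinearGroup.det.comp (Pi.evalMonoidHom (fun a : Fin 3 => GL {i : Fin 3 // (id : Fin 3 → Fin 3) i = a} F) a))) m : ℂˣ) : ℂ)) ≠ 0 := by rw [s.1]; exact one_ne_zero
  exact nonempty_equiv_of_finrank_weightSpace_eq_one ρ N.toRepresentation hρ hRs _ mI1 h1 hN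

set_option maxHeartbeats 800000 in  -- six weights: case bookkeeping as in file 1
/-- **AN IRREDUCIBLE WITH A class_B WEIGHT IS `≅ I θ ⁄ N`**: for `ρ` irreducible smooth with `r_B ρ` finite-dimensional and `mult ρ Bᵢ ≠ 0` for some `i`, `ρ ≅ I θ ⁄ N` —
the ★ H0 swaps move the weight to `B₃ = tch ![z,y,x]`, which has multiplicity one in `I ![z,y,x]` (★ REG; `![z,y,x]` is regular too); `I θ ⁄ N` is irreducible (§1) and
carries `B₃` (★ file 1); ★ UNIQ (b) inside `I ![z,y,x]` — no intertwining operator. [cite: BernsteinZelevinsky1977, Cor. 2.13, Thm. 2.9] [cite: Zelevinsky1980, Thm. 6.1] -/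
theorem nonempty_equiv_quotient_of_classB (hx : IsOpen ((x.ker : Subgroup Fˣ) : Set Fˣ)) (hy : IsOpen ((y.ker : Subgroup Fˣ) : Set Fˣ))
    (hz : IsOpen ((z.ker : Subgroup Fˣ) : Set Fˣ)) (hinj : Function.Injective (![x, y, z] : Fin 3 → (Fˣ →* ℂˣ)))
    (u₁ : (parabolicIndGL F (lastBlockLabel 2) ((Representation.trivial ℂ (Π a : Bool, GL {i : Fin 2 // lastBlockLabel 2 i = a} F) ℂ).twist (maxParabolicLeviChar F 2 (y) (z)))).IsIrreducible)
    (u₂ : (parabolicIndGL F (lastBlockLabel 2) ((Representation.trivial ℂ (Π a : Bool, GL {i : Fin 2 // lastBlockLabel 2 i = a} F) ℂ).twist (maxParabolicLeviChar F 2 (z) (y)))).IsIrreducible)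
    (u₃ : (parabolicIndGL F (lastBlockLabel 2) ((Representation.trivial ℂ (Π a : Bool, GL {i : Fin 2 // lastBlockLabel 2 i = a} F) ℂ).twist (maxParabolicLeviChar F 2 (x) (z)))).IsIrreducible)
    (u₄ : (parabolicIndGL F (lastBlockLabel 2) ((Representation.trivial ℂ (Π a : Bool, GL {i : Fin 2 // lastBlockLabel 2 i = a} F) ℂ).twist (maxParabolicLeviChar F 2 (z) (x)))).IsIrreducible)
    (h3cell : ∀ c : Fin 3 → Fin 2, Monotone c → Function.Surjective c →
      ∀ (W : Type) [AddCommGroup W] [Module ℂ W] (σ : Representation ℂ (Π a : Fin 2, GL {i : Fin 3 // c i = a} F) W),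
        σ.IsIrreducible → σ.IsSmooth → σ.IsSupercuspidal →
        ∀ (N : Subrepresentation (jacquetGL F c (parabolicIndGL F (id : Fin 3 → Fin 3) ((Representation.trivial ℂ (Π a : Fin 3, GL {i : Fin 3 // (id : Fin 3 → Fin 3) i = a} F) ℂ).twist (∏ a : Fin 3, (((![x, y, z] : Fin 3 → (Fˣ →* ℂˣ))) a).comp (Matrix.GeneralLinearGroup.det.comp (Pi.evalMonoidHom (fun a : Fin 3 => GL {i : Fin 3 // (id : Fin 3 → Fin 3) i = a} F) a)))))))
          (q : N.toRepresentation.IntertwiningMap σ), q = 0)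
    (N : Subrepresentation (parabolicIndGL F (id : Fin 3 → Fin 3) ((Representation.trivial ℂ (Π a : Fin 3, GL {i : Fin 3 // (id : Fin 3 → Fin 3) i = a} F) ℂ).twist (∏ a : Fin 3, (((![x, y, z] : Fin 3 → (Fˣ →* ℂˣ))) a).comp (Matrix.GeneralLinearGroup.det.comp (Pi.evalMonoidHom (fun a : Fin 3 => GL {i : Fin 3 // (id : Fin 3 → Fin 3) i = a} F) a))))))
    (hN0 : N ≠ ⊥) (hN1 : N ≠ ⊤) [ρ.IsIrreducible] (hρ : ρ.IsSmooth) [FiniteDimensional ℂ (restrictUnipotentGL F (id : Fin 3 → Fin 3) ρ).Coinvariants]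
    (hw : finrank ℂ ↥(⨅ m, Module.End.maxGenEigenspace (normalizedJacquetGL F (id : Fin 3 → Fin 3) ρ m) (((∏ a : Fin 3, (((![y, x, z] : Fin 3 → (Fˣ →* ℂˣ))) a).comp (Matrix.GeneralLinearGroup.det.comp (Pi.evalMonoidHom (fun a : Fin 3 => GL {i : Fin 3 // (id : Fin 3 → Fin 3) i = a} F) a))) m : ℂˣ) : ℂ)) ≠ 0 ∨
      finrank ℂ ↥(⨅ m, Module.End.maxGenEigenspace (normalizedJacquetGL F (id : Fin 3 → Fin 3) ρ m) (((∏ a : Fin 3, (((![y, z, x] : Fin 3 → (Fˣ →* ℂˣ))) a).comp (Matrix.GeneralLinearGroup.det.comp (Pi.evalMonoidHom (fun a : Fin 3 => GL {i : Fin 3 // (id : Fin 3 → Fin 3) i = a} F) a))) m : ℂˣ) : ℂ)) ≠ 0 ∨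
      finrank ℂ ↥(⨅ m, Module.End.maxGenEigenspace (normalizedJacquetGL F (id : Fin 3 → Fin 3) ρ m) (((∏ a : Fin 3, (((![z, y, x] : Fin 3 → (Fˣ →* ℂˣ))) a).comp (Matrix.GeneralLinearGroup.det.comp (Pi.evalMonoidHom (fun a : Fin 3 => GL {i : Fin 3 // (id : Fin 3 → Fin 3) i = a} F) a))) m : ℂˣ) : ℂ)) ≠ 0) :
    Nonempty (ρ.Equiv N.quotientRep) := by
  have hθo : ∀ i, IsOpen ((((![x, y, z] : Fin 3 → (Fˣ →* ℂˣ)) i).ker : Subgroup Fˣ) : Set Fˣ) := fun i => by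
    fin_cases i
    · exact hx
    · exact hy
    · exact hz
  have hθo' : ∀ i, IsOpen ((((![z, y, x] : Fin 3 → (Fˣ →* ℂˣ)) i).ker : Subgroup Fˣ) : Set Fˣ) := fun i => by
    fin_cases i
    · exact hz
    · exact hy
    · exact hx
  have hinj' : Function.Injective (![z, y, x] : Fin 3 → (Fˣ →* ℂˣ)) := by
    intro i j hij
    have key : ∀ i : Fin 3, (![z, y, x] : Fin 3 → (Fˣ →* ℂˣ)) i = (![x, y, z] : Fin 3 → (Fˣ →* ℂˣ)) ((Equiv.swap (0 : Fin 3) 2) i) := fun i => by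
      fin_cases i <;> rfl
    rw [key, key] at hij
    exact (Equiv.swap (0 : Fin 3) 2).injective (hinj hij)
  have hIs : (parabolicIndGL F (id : Fin 3 → Fin 3) ((Representation.trivial ℂ (Π a : Fin 3, GL {i : Fin 3 // (id : Fin 3 → Fin 3) i = a} F) ℂ).twist (∏ a : Fin 3, (((![x, y, z] : Fin 3 → (Fˣ →* ℂˣ))) a).comp (Matrix.GeneralLinearGroup.det.comp (Pi.evalMonoidHom (fun a : Fin 3 => GL {i : Fin 3 // (id : Fin 3 → Fin 3) i = a} F) a))))).IsSmooth := Representation.isSmooth_smoothInd _ _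
  haveI hIfd : FiniteDimensional ℂ (restrictUnipotentGL F (id : Fin 3 → Fin 3) (parabolicIndGL F (id : Fin 3 → Fin 3) ((Representation.trivial ℂ (Π a : Fin 3, GL {i : Fin 3 // (id : Fin 3 → Fin 3) i = a} F) ℂ).twist (∏ a : Fin 3, (((![x, y, z] : Fin 3 → (Fˣ →* ℂˣ))) a).comp (Matrix.GeneralLinearGroup.det.comp (Pi.evalMonoidHom (fun a : Fin 3 => GL {i : Fin 3 // (id : Fin 3 → Fin 3) i = a} F) a)))))).Coinvariants :=
    (finrank_weightSpace_principalSeries_three_tch (![x, y, z] : Fin 3 → (Fˣ →* ℂˣ)) (isOpen_ker_tch _ hθo) (fun _ => 0)).1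
  haveI hIfd' : FiniteDimensional ℂ (restrictUnipotentGL F (id : Fin 3 → Fin 3) (parabolicIndGL F (id : Fin 3 → Fin 3) ((Representation.trivial ℂ (Π a : Fin 3, GL {i : Fin 3 // (id : Fin 3 → Fin 3) i = a} F) ℂ).twist (∏ a : Fin 3, (((![z, y, x] : Fin 3 → (Fˣ →* ℂˣ))) a).comp (Matrix.GeneralLinearGroup.det.comp (Pi.evalMonoidHom (fun a : Fin 3 => GL {i : Fin 3 // (id : Fin 3 → Fin 3) i = a} F) a)))))).Coinvariants :=
    (finrank_weightSpace_principalSeries_three_tch (![z, y, x] : Fin 3 → (Fˣ →* ℂˣ)) (isOpen_ker_tch _ hθo') (fun _ => 0)).1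
  have hSs : N.quotientRep.IsSmooth := hIs.quotientRep N
  haveI : FiniteDimensional ℂ (restrictUnipotentGL F (id : Fin 3 → Fin 3) N.quotientRep).Coinvariants := finiteDimensional_jacquet_quotientRep _ N
  haveI := isIrreducible_quotient x y z hx hy hz hinj u₁ u₂ u₃ u₄ h3cell N hN0 hN1
  have s := finrank_weightSpace_sub_and_quotient x y z hx hy hz hinj u₁ u₂ u₃ u₄ h3cell N hN0 hN1
  have mI6 : finrank ℂ ↥(⨅ m, Module.End.maxGenEigenspace (normalizedJacquetGL F (id : Fin 3 → Fin 3) (parabolicIndGL F (id : Fin 3 → Fin 3) ((Representation.trivial ℂ (Π a : Fin 3, GL {i : Fin 3 // (id : Fin 3 → Fin 3) i = a} F) ℂ).twist (∏ a : Fin 3, (((![z, y, x] : Fin 3 → (Fˣ →* ℂˣ))) a).comp (Matrix.GeneralLinearGroup.det.comp (Pi.evalMonoidHom (fun a : Fin 3 => GL {i : Fin 3 // (id : Fin 3 → Fin 3) i = a} F) a))))) m) (((∏ a : Fin 3, (((![z, y, x] : Fin 3 → (Fˣ →* ℂˣ))) a).comp (Matrix.GeneralLinearGroup.det.comp (Pi.evalMonoidHom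 (fun a : Fin 3 => GL {i : Fin 3 // (id : Fin 3 → Fin 3) i = a} F) a))) m : ℂˣ) : ℂ)) = 1 :=
    finrank_weightSpace_principalSeries_perm_eq_one _ hθo' hinj' 1 _ (fun i => by fin_cases i <;> rfl)
  have r12 : finrank ℂ ↥(⨅ m, Module.End.maxGenEigenspace (normalizedJacquetGL F (id : Fin 3 → Fin 3) ρ m) (((∏ a : Fin 3, (((![y, x, z] : Fin 3 → (Fˣ →* ℂˣ))) a).comp (Matrix.GeneralLinearGroup.det.comp (Pi.evalMonoidHom (fun a : Fin 3 => GL {i : Fin 3 // (id : Fin 3 → Fin 3) i = a} F) a))) m : ℂˣ) : ℂ)) = finrank ℂ ↥(⨅ m, Module.End.maxGenEigenspace (normalizedJacquetGL F (id : Fin 3 → Fin 3) ρ m) (((∏ a : Fin 3, (((![y, z, x] : Fin 3 → (Fˣ →* ℂˣ))) a).comp (Matrix.GeneralLinearGroup.det.comp (Pi.evalMonoidHom (fun a : Fin 3 => GL {i : Fin 3 // (id : Fin 3 → Fin 3) i = a} F) a))) m : ℂˣ) : ℂ)) := finrank_weightSpace_swap₁₂ _ hρ _ _ _ hx hz u₃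 u₄
  have r23 : finrank ℂ ↥(⨅ m, Module.End.maxGenEigenspace (normalizedJacquetGL F (id : Fin 3 → Fin 3) ρ m) (((∏ a : Fin 3, (((![y, z, x] : Fin 3 → (Fˣ →* ℂˣ))) a).comp (Matrix.GeneralLinearGroup.det.comp (Pi.evalMonoidHom (fun a : Fin 3 => GL {i : Fin 3 // (id : Fin 3 → Fin 3) i = a} F) a))) m : ℂˣ) : ℂ)) = finrank ℂ ↥(⨅ m, Module.End.maxGenEigenspace (normalizedJacquetGL F (id : Fin 3 → Fin 3) ρ m) (((∏ a : Fin 3, (((![z, y, x] : Fin 3 → (Fˣ →* ℂˣ))) a).comp (Matrix.GeneralLinearGroup.det.comp (Pi.evalMonoidHom (fun a : Fin 3 => GL {i : Fin 3 // (id : Fin 3 → Fin 3) i = a} F) a))) m : ℂˣ) : ℂ)) := finrank_weightSpace_swap₀₁ _ hρ _ _ _ hy hz u₁ u₂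
  have h3 : finrank ℂ ↥(⨅ m, Module.End.maxGenEigenspace (normalizedJacquetGL F (id : Fin 3 → Fin 3) ρ m) (((∏ a : Fin 3, (((![z, y, x] : Fin 3 → (Fˣ →* ℂˣ))) a).comp (Matrix.GeneralLinearGroup.det.comp (Pi.evalMonoidHom (fun a : Fin 3 => GL {i : Fin 3 // (id : Fin 3 → Fin 3) i = a} F) a))) m : ℂˣ) : ℂ)) ≠ 0 := by
    rcases hw with h | h | h
    · exact fun h0 => h (r12.trans (r23.trans h0))
    · exact fun h0 => h (r23.trans h0)
    · exact h
  have hS : finrank ℂ ↥(⨅ m, Module.End.maxGenEigenspace (normalizedJacquetGL F (id : Fin 3 → Fin 3) N.quotientRep m) (((∏ a : Fin 3, (((![z, y, x] : Fin 3 → (Fˣ →* ℂˣ))) a).comp (Matrix.GeneralLinearGroup.det.comp (Pi.evalMonoidHom (fun a : Fin 3 => GL {i : Fin 3 // (id : Fin 3 → Fin 3) i = a} F) a))) m : ℂˣ) : ℂ)) ≠ 0 := by rw [s.2.2.2.2.2.2.2.2.2.2.2]; exact one_ne_zero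
  exact nonempty_equiv_of_finrank_weightSpace_eq_one ρ N.quotientRep hρ hSs _ mI6 h3 hS

end Identification

/-! ## §3 The trace of the quotient -/

/-- **`tr (I θ ⁄ N) = tr (I θ) − tr N`** on every test function (★ `smoothTrace_eq_add_of_subrepresentation`; `I θ` is admissible by ★ `isAdmissible_parabolicIndGL_holds` applied to
the smooth character `tch θ`). [cite: BernsteinZelevinsky1977, §2.3] -/
theorem smoothTrace_quotient_eq_sub (hx : IsOpen ((x.ker : Subgroup Fˣ) : Set Fˣ)) (hy : IsOpen ((y.ker : Subgroup Fˣ) : Set Fˣ))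
    (hz : IsOpen ((z.ker : Subgroup Fˣ) : Set Fˣ)) [MeasurableSpace (GL (Fin 3) F)] [BorelSpace (GL (Fin 3) F)]
    (μ : Measure (GL (Fin 3) F)) [μ.IsHaarMeasure] (N : Subrepresentation (parabolicIndGL F (id : Fin 3 → Fin 3) ((Representation.trivial ℂ (Π a : Fin 3, GL {i : Fin 3 // (id : Fin 3 → Fin 3) i = a} F) ℂ).twist (∏ a : Fin 3, (((![x, y, z] : Fin 3 → (Fˣ →* ℂˣ))) a).comp (Matrix.GeneralLinearGroup.det.comp (Pi.evalMonoidHom (fun a : Fin 3 => GL {i : Fin 3 // (id : Fin 3 → Fin 3) i = a} F) a)))))) (f : GL (Fin 3) F → ℂ) :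
    N.quotientRep.smoothTrace μ f = (parabolicIndGL F (id : Fin 3 → Fin 3) ((Representation.trivial ℂ (Π a : Fin 3, GL {i : Fin 3 // (id : Fin 3 → Fin 3) i = a} F) ℂ).twist (∏ a : Fin 3, (((![x, y, z] : Fin 3 → (Fˣ →* ℂˣ))) a).comp (Matrix.GeneralLinearGroup.det.comp (Pi.evalMonoidHom (fun a : Fin 3 => GL {i : Fin 3 // (id : Fin 3 → Fin 3) i = a} F) a))))).smoothTrace μ f - N.toRepresentation.smoothTrace μ f := by
  have hθo : ∀ i, IsOpen ((((![x, y, z] : Fin 3 → (Fˣ →* ℂˣ)) i).ker : Subgroup Fˣ) : Set Fˣ) := fun i => by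
    fin_cases i
    · exact hx
    · exact hy
    · exact hz
  have hadm : (parabolicIndGL F (id : Fin 3 → Fin 3) ((Representation.trivial ℂ (Π a : Fin 3, GL {i : Fin 3 // (id : Fin 3 → Fin 3) i = a} F) ℂ).twist (∏ a : Fin 3, (((![x, y, z] : Fin 3 → (Fˣ →* ℂˣ))) a).comp (Matrix.GeneralLinearGroup.det.comp (Pi.evalMonoidHom (fun a : Fin 3 => GL {i : Fin 3 // (id : Fin 3 → Fin 3) i = a} F) a))))).IsAdmissible :=
    Representation.isAdmissible_parabolicIndGL_holds F (id : Fin 3 → Fin 3) _ (isAdmissible_trivial_twist (isOpen_ker_tch _ hθo))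
  rw [(parabolicIndGL F (id : Fin 3 → Fin 3) ((Representation.trivial ℂ (Π a : Fin 3, GL {i : Fin 3 // (id : Fin 3 → Fin 3) i = a} F) ℂ).twist (∏ a : Fin 3, (((![x, y, z] : Fin 3 → (Fˣ →* ℂˣ))) a).comp (Matrix.GeneralLinearGroup.det.comp (Pi.evalMonoidHom (fun a : Fin 3 => GL {i : Fin 3 // (id : Fin 3 → Fin 3) i = a} F) a))))).smoothTrace_eq_add_of_subrepresentation μ hadm N f]
  ring

end Summit.HodgeConjecture.HodgeConjecture.Cruxes.H413.K2E3GL3OneLinkGenericStructure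

end
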